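import Literature.AlgebraicGeometry.Resolution.QuadraticTransformsChart
import Literature.AlgebraicGeometry.Resolution.QuadraticTransformsUFD
import Mathlib.RingTheory.Coprime.Lemmas
import HarnessLib

/-!
# Abhyankar's factorization theorem, I: the key lemma `𝔪_R T = x T`

Topic: `Literature/AlgebraicGeometry/Resolution`. Support file for the discharge of the named fact
`AbhyankarQuadraticFactorization` (`QuadraticTransforms.lean`: Abhyankar 1956, Thm. 3, as quoted by
Cutkosky 2014, Thm. 2.1), following the proof of Huneke–Swanson, *Integral Closure of Ideals,
Rings, and Modules*, Thm. 14.5.2 (book pp. 276–277), whose "crucial point" is: **if `R ⊊ T` are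
two-dimensional regular local rings with the same fraction field `K`, `T` dominating `R`, then
`𝔪_R T = xT` for some `x ∈ 𝔪_R`**, i.e. `T ⊇ R[𝔪_R/x]` (`exists_rsop_div_mem_of_ne`). Huneke–Swanson
deduce this from Sally's theorem on the analytic spread (their Thm. 8.8.1); here it is PROVED by an
elementary argument in the same spirit (compare their Lemma 8.8.2 (1)), using only that
two-dimensional regular local rings are UFDs (`QuadraticTransformsUFD.lean`) and the structure of
the chart `R[y/x]` (`QuadraticTransformsChart.lean`):

* `exists_maximalIdeal_eq_span_pair` — a regular system of parameters `𝔪_R = (x, y)` of a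
  two-dimensional regular local ring, `x, y` prime, neither dividing the other.
* Write `x = d x'`, `y = d y'` in the UFD `T` with `x', y'` relatively prime. If `x'` (or `y'`) is
  a unit then `y/x = y'/x' ∈ T` and we are done. Otherwise:
  (i) `gcd_mem_maximalIdeal`: `d ∈ 𝔪_T` — an element `t ∈ T ∖ R` is `a/b` in lowest terms over
  the UFD `R`, with `a, b ∈ 𝔪_R`, so `(a, b) ⊇ 𝔪_Rᴺ` (`exists_pow_maximalIdeal_le_span_pair`),
  whence `b ∣ xᴺ, yᴺ` in `T`, so `b ∣ dᴺ` and `d` is a non-unit;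
  (ii)–(iii) `false_of_not_isUnit`: with `u = y'/x'`, `A = R[u] ⊆ B = T[u]`, the exceptional prime
  `𝔭 = 𝔪_R A = xA` and the prime `P = 𝔪_T B` (quasi-regularity of `x', y'`), domination gives
  `P ∩ A ⊆ 𝔭`, so the discrete valuation ring `V = A_𝔭` lies in `D = B_P ∌ 1/x`, forcing `D = V ⊇ T`
  with the non-zero elements of `𝔪_T` non-units of `V`; then `x' ∈ xV` yields `d⁻¹ ∈ V`, so `d` is
  a unit of `T` — contradiction.

## Sources

* S. Abhyankar, *On the valuations centered in a local domain*, Amer. J. Math. 78 (1956),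
  321–348, Thm. 3. [Abhyankar1956Valuations]
* S. D. Cutkosky, *Counterexamples to local monomialization in positive characteristic*,
  Math. Ann. 362 (2015), Thm. 2.1 (arXiv:1404.7459, p. 4). [Cutkosky2014]
* C. Huneke, I. Swanson, *Integral Closure of Ideals, Rings, and Modules*, CUP 2006, Thm. 14.5.2
  and its proof (book pp. 276–277), Lemma 8.8.2. [HunekeSwanson2006]
-/

noncomputable section

namespace Literature.AlgebraicGeometry.Resolution

universe u

open IsLocalRing Polynomial

variable {K : Type u} [Field K]

/-! ## Regular system of parameters of a two-dimensional regular local ring -/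

section RSOP

variable {R : Type u} [CommRing R] [IsRegularLocalRing R]

/-- In a two-dimensional regular local ring the maximal ideal is not principal. [folklore] -/
theorem maximalIdeal_ne_span_singleton (hdim : ringKrullDim R = 2) (z : R) :
    maximalIdeal R ≠ Ideal.span {z} := by
  intro hz
  have hfr : (maximalIdeal R).spanFinrank = 2 := by
    have := (isRegularLocalRing_iff R).mp ‹_›
    rw [hdim] at this
    exact_mod_cast this
  have h1 := Submodule.spanFinrank_span_le_ncard_of_finite (R := R) (M := R)
    (Set.finite_singleton z)
  rw [Set.ncard_singleton] at h1
  have h2 : (maximalIdeal R).spanFinrank ≤ 1 := by rw [hz]; exact h1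
  omega

/-- **A regular system of parameters of a two-dimensional regular local ring**: `𝔪 = (x, y)`
with `x`, `y` prime elements (both lie in `𝔪 ∖ 𝔪²`, Matsumura Thm. 14.2–14.3) and neither
dividing the other. [cite: Matsumura1987, Thm. 14.3] -/
theorem exists_maximalIdeal_eq_span_pair (hdim : ringKrullDim R = 2) :
    ∃ x y : R, maximalIdeal R = Ideal.span {x, y} ∧ Prime x ∧ Prime y ∧ ¬ x ∣ y ∧ ¬ y ∣ x := by
  have hfr : (maximalIdeal R).spanFinrank = 2 := by
    have := (isRegularLocalRing_iff R).mp ‹_›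
    rw [hdim] at this
    exact_mod_cast this
  have hne1 := maximalIdeal_ne_span_singleton hdim
  obtain ⟨x, hx, hx2⟩ :=
    IsRegularLocalRing.exists_not_mem_sq (R := R) (ringKrullDim_ne_zero_of_eq_two hdim)
  obtain ⟨s, hsfin, hscard, hspan⟩ := exists_span_insert_eq_maximalIdeal hx hx2
  rw [hfr] at hscard
  have hs1 : s.ncard = 1 := by
    rcases Nat.lt_or_ge s.ncard 1 with h | h
    · exfalso
      have hs0 : s = ∅ := (Set.ncard_eq_zero hsfin).mp (by omega)
      rw [hs0, ← Set.singleton_def] at hspan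
      exact hne1 x hspan.symm
    · omega
  obtain ⟨y, rfl⟩ := Set.ncard_eq_one.mp hs1
  have hm : maximalIdeal R = Ideal.span {x, y} := hspan.symm
  have key : ∀ a b : R, maximalIdeal R = Ideal.span {a, b} → ¬ a ∣ b := by
    intro a b hab hdvd
    apply hne1 a
    rw [hab]
    apply le_antisymm
    · rw [Ideal.span_le]
      rintro _ (rfl | rfl)
      · exact Ideal.mem_span_singleton_self _
      · exact Ideal.mem_span_singleton.mpr hdvd
    · exact Ideal.span_mono (Set.singleton_subset_iff.mpr (Set.mem_insert _ _))
  have hxy : ¬ x ∣ y := key x y hm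
  have hyx : ¬ y ∣ x := key y x (by rw [hm, Set.pair_comm])
  have hy : y ∈ maximalIdeal R := hm ▸ Ideal.subset_span (by simp)
  have hy2 : y ∉ maximalIdeal R ^ 2 := by
    intro hy2
    apply hne1 x
    refine le_antisymm ?_ ((Ideal.span_singleton_le_iff_mem _).mpr hx)
    refine Submodule.le_of_le_smul_of_le_jacobson_bot (IsNoetherian.noetherian _)
      (maximalIdeal_le_jacobson _) ?_
    conv_lhs => rw [hm]
    rw [Ideal.span_le]
    rintro _ (rfl | rfl)
    · exact Submodule.mem_sup_left (Ideal.mem_span_singleton_self _)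
    · refine Submodule.mem_sup_right ?_
      rw [Ideal.smul_eq_mul, ← pow_two]
      exact hy2
  exact ⟨x, y, hm, IsRegularLocalRing.prime_of_not_mem_sq hx hx2,
    IsRegularLocalRing.prime_of_not_mem_sq hy hy2, hxy, hyx⟩

end RSOP

/-! ## The key lemma: `𝔪_R T` is principal -/

section KeyLemma

variable {R T : Subring K}

/-- Under domination `𝔪_T ∩ R = 𝔪_R`: an element of `R` is in `𝔪_T` iff it is in `𝔪_R`.
[cite: Cutkosky2014, §2.1] -/
theorem incl_mem_maximalIdeal_iff [IsLocalRing R] [IsLocalRing T] (h : SubringDominates R T)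
    (t : R) : Subring.inclusion h.1 t ∈ maximalIdeal T ↔ t ∈ maximalIdeal R := by
  rw [mem_maximalIdeal_iff_inv_not_mem, mem_maximalIdeal_iff_inv_not_mem, Subring.coe_inclusion]
  constructor
  · rintro (h0 | hni)
    · exact Or.inl h0
    · exact Or.inr fun hR => hni (h.1 hR)
  · rintro (h0 | hni)
    · exact Or.inl h0
    · exact Or.inr fun hT => hni (h.2 _ t.2 hT)

variable (hR : IsRegularLocalRing R) (hRdim : ringKrullDim R = 2) (hRK : IsLocalRingOf R)
  (hT : IsRegularLocalRing T) (hTdim : ringKrullDim T = 2) (hdom : SubringDominates R T)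

include hR hRdim hRK hT hTdim hdom in
/-- **Step (i) of the key lemma.** Let `R ⊊ T` be two-dimensional regular local rings of `K`,
`T` dominating `R`, `𝔪_R = (x, y)`, and in the UFD `T` write `x = d x'`, `y = d y'` with
`x', y'` relatively prime. Then `d ∈ 𝔪_T`: an element `t ∈ T ∖ R` is `a/b` in lowest terms over
the UFD `R` with `a, b ∈ 𝔪_R`, so `(a, b) ⊇ 𝔪_Rᴺ`, whence `b ∣ xᴺ, yᴺ` in `T`, so `b ∣ dᴺ`, and
`b` is not a unit of `T`. [folklore] -/
theorem gcd_mem_maximalIdeal (hne : R ≠ T) {x y : R} (hm : maximalIdeal R = Ideal.span {x, y})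
    {x' y' d : T} (hrel : IsRelPrime x' y') (hdx : d * x' = Subring.inclusion hdom.1 x)
    (hdy : d * y' = Subring.inclusion hdom.1 y) : d ∈ maximalIdeal T := by
  haveI := hR
  haveI := hT
  haveI := uniqueFactorizationMonoid_of_ringKrullDim_eq_two hRdim
  haveI := uniqueFactorizationMonoid_of_ringKrullDim_eq_two hTdim
  have hRT : R ≤ T := hdom.1
  set ι := Subring.inclusion hRT with hι
  -- an element of `T ∖ R`, as a fraction over `R` in lowest terms
  obtain ⟨t, htT, htR⟩ : ∃ t ∈ T, t ∉ R := by
    by_contra! h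
    exact hne (le_antisymm hRT h)
  obtain ⟨a₀, ha₀, b₀, hb₀, hb₀0, rfl⟩ := hRK.2 t
  obtain ⟨b', a', c, hrel', hcb, hca⟩ := UniqueFactorizationMonoid.exists_reduced_factors
    (⟨b₀, hb₀⟩ : R) (fun h => hb₀0 (congrArg Subtype.val h)) ⟨a₀, ha₀⟩
  have hc0 : (c : K) ≠ 0 := by
    intro h
    have : c = 0 := Subtype.ext h
    rw [this, zero_mul] at hcb
    exact hb₀0 (congrArg Subtype.val hcb).symm
  have hb'0 : ((b' : R) : K) ≠ 0 := by
    intro h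
    have : b' = 0 := Subtype.ext h
    rw [this, mul_zero] at hcb
    exact hb₀0 (congrArg Subtype.val hcb).symm
  have ht : a₀ / b₀ = (a' : K) / b' := by
    have e1 : a₀ = (c : K) * a' := by
      have := congrArg Subtype.val hca; simpa using this.symm
    have e2 : b₀ = (c : K) * b' := by
      have := congrArg Subtype.val hcb; simpa using this.symm
    rw [e1, e2, mul_div_mul_left _ _ hc0]
  -- `b' ∈ 𝔪_R` (else `t ∈ R`) and `a' ∈ 𝔪_R` (else `t⁻¹ ∈ R`, so `t ∈ R` by domination)
  have hb'm : b' ∈ maximalIdeal R := by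
    by_contra hu
    rw [IsLocalRing.mem_maximalIdeal, mem_nonunits_iff, not_not] at hu
    apply htR
    rw [ht, div_eq_mul_inv]
    exact R.mul_mem a'.2 ((isUnit_subring_iff_inv_mem b').mp hu).2
  have ha'm : a' ∈ maximalIdeal R := by
    by_contra hu
    rw [IsLocalRing.mem_maximalIdeal, mem_nonunits_iff, not_not] at hu
    apply htR
    have hinv : (a₀ / b₀)⁻¹ ∈ R := by
      rw [ht, inv_div, div_eq_mul_inv]
      exact R.mul_mem b'.2 ((isUnit_subring_iff_inv_mem a').mp hu).2
    have := hdom.2 _ hinv (by rw [inv_inv]; exact htT)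
    rwa [inv_inv] at this
  -- `𝔪_Rᴺ ⊆ (a', b')`
  obtain ⟨N, hN⟩ := exists_pow_maximalIdeal_le_span_pair hRdim hrel'.symm
  have hxN : x ^ N ∈ Ideal.span {a', b'} :=
    hN (Ideal.pow_mem_pow (hm ▸ Ideal.subset_span (by simp)) N)
  have hyN : y ^ N ∈ Ideal.span {a', b'} :=
    hN (Ideal.pow_mem_pow (hm ▸ Ideal.subset_span (by simp)) N)
  -- in `T`, `b'` divides every element of `(a', b')`, as `a' = t b'` with `t ∈ T`
  have key : ∀ z : R, z ∈ Ideal.span {a', b'} → ι b' ∣ ι z := by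
    intro z hz
    obtain ⟨α, β, rfl⟩ := Ideal.mem_span_pair.mp hz
    refine ⟨⟨(α : K) * (a₀ / b₀) + β, T.add_mem (T.mul_mem (hRT α.2) htT) (hRT β.2)⟩,
      Subtype.ext ?_⟩
    simp only [hι, Subring.coe_inclusion, Subring.coe_mul, Subring.coe_add]
    rw [ht]
    field_simp
  have h1 : ι b' ∣ d ^ N * x' ^ N := by
    have := key _ hxN; rwa [map_pow, ← hdx, mul_pow] at this
  have h2 : ι b' ∣ d ^ N * y' ^ N := by
    have := key _ hyN; rwa [map_pow, ← hdy, mul_pow] at this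
  have hιb'0 : ι b' ≠ 0 := by
    intro h
    apply hb'0
    have := congrArg (fun s : T => (s : K)) h
    simpa [hι] using this
  -- hence `b' ∣ dᴺ`
  have h3 : ι b' ∣ d ^ N := by
    obtain ⟨b'', c'', e, hrel'', heb, hec⟩ :=
      UniqueFactorizationMonoid.exists_reduced_factors (ι b') hιb'0 (d ^ N)
    have he0 : e ≠ 0 := by
      rintro rfl
      rw [zero_mul] at heb
      exact hιb'0 heb.symm
    rw [← heb, ← hec] at h1 h2 ⊢
    have h1' : b'' ∣ x' ^ N := by
      rw [mul_assoc] at h1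
      exact hrel''.dvd_of_dvd_mul_left ((mul_dvd_mul_iff_left he0).mp h1)
    have h2' : b'' ∣ y' ^ N := by
      rw [mul_assoc] at h2
      exact hrel''.dvd_of_dvd_mul_left ((mul_dvd_mul_iff_left he0).mp h2)
    have hunit : IsUnit b'' := hrel.pow h1' h2'
    exact mul_dvd_mul_left e hunit.dvd
  -- `b' ∈ 𝔪_T` by domination, so `dᴺ ∈ 𝔪_T`
  have hb'n : ι b' ∈ maximalIdeal T := (incl_mem_maximalIdeal_iff hdom b').mpr hb'm
  obtain ⟨c₃, hc₃⟩ := h3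
  have hdN : d ^ N ∈ maximalIdeal T := by
    rw [hc₃]; exact Ideal.mul_mem_right _ _ hb'n
  exact Ideal.IsPrime.mem_of_pow_mem inferInstance N hdN

include hR hRK hT hdom in
/-- **Steps (ii)–(iii) of the key lemma.** In the situation of `gcd_mem_maximalIdeal`, it is
impossible that both `x'` and `y'` are non-units of `T`. For then, with `u = y/x = y'/x'`,
`A = R[u] ⊆ B = T[u]`, the exceptional prime `𝔭 = 𝔪_R A = xA` of `A` and the prime
`P = 𝔪_T B` of `B` (prime by quasi-regularity of `x', y'`), one has `P ∩ A ⊆ 𝔭` (domination),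
so the discrete valuation ring `V = A_𝔭` lies in `D = B_P`; as `1/x ∉ D` this forces
`D = V`, so `T ⊆ V` with `𝔪_T ∖ 0` consisting of non-units of `V`, i.e. of multiples of `x`;
then `x' ∈ xV` gives `d⁻¹ ∈ V`, contradicting `d ∈ 𝔪_T`. (Compare Huneke–Swanson, Lemma 8.8.2 (1):
if `𝔪_R T` has analytic spread two then `T` lies in the order valuation ring of `R`.) [folklore] -/
theorem false_of_not_isUnit {x y : R} (hm : maximalIdeal R = Ideal.span {x, y}) (hx : Prime x)
    (hxy : ¬ x ∣ y) {x' y' d : T} (hrel : IsRelPrime x' y')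
    (hdx : d * x' = Subring.inclusion hdom.1 x) (hdy : d * y' = Subring.inclusion hdom.1 y)
    (hx'n : x' ∈ maximalIdeal T) (hy'n : y' ∈ maximalIdeal T) (hdn : d ∈ maximalIdeal T)
    [UniqueFactorizationMonoid T] : False := by
  haveI := hR
  haveI := hT
  have hRT : R ≤ T := hdom.1
  set ι := Subring.inclusion hRT with hι
  have hx0 : x ≠ 0 := hx.ne_zero
  have hx0K : ((x : R) : K) ≠ 0 := fun e => hx0 (Subtype.ext e)
  have hxK : ((x : R) : K) = (d : K) * (x' : K) := by
    have := congrArg (fun s : T => (s : K)) hdx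
    simpa [hι] using this.symm
  have hyK : ((y : R) : K) = (d : K) * (y' : K) := by
    have := congrArg (fun s : T => (s : K)) hdy
    simpa [hι] using this.symm
  have hd0K : ((d : T) : K) ≠ 0 := by
    intro h; rw [h, zero_mul] at hxK; exact hx0K hxK
  have hd0 : d ≠ 0 := fun e => hd0K (by rw [e]; rfl)
  have hx'0K : ((x' : T) : K) ≠ 0 := by
    intro h; rw [h, mul_zero] at hxK; exact hx0K hxK
  have hx'0 : x' ≠ 0 := fun e => hx'0K (by rw [e]; rfl)
  have hpqR : ∀ t : R, x ∣ y * t → x ∣ t := fun t h => (hx.dvd_or_dvd h).resolve_left hxy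
  have hpqT : ∀ t : T, x' ∣ y' * t → x' ∣ t := fun t h => hrel.dvd_of_dvd_mul_left h
  have hxm : x ∈ maximalIdeal R := hm ▸ Ideal.subset_span (by simp)
  have hym : y ∈ maximalIdeal R := hm ▸ Ideal.subset_span (by simp)
  -- the common element `u = y/x = y'/x'`
  set u : K := ((y' : T) : K) / ((x' : T) : K) with hu
  have huR : ((y : R) : K) / ((x : R) : K) = u := by
    rw [hxK, hyK, mul_div_mul_left _ _ hd0K]
  -- the rings `A = R[u] ⊆ B = T[u]`
  set A := (Algebra.adjoin R {u}).toSubring with hA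
  set B := (Algebra.adjoin T {u}).toSubring with hB
  haveI : IsNoetherianRing A := isNoetherianRing_adjoin_toSubring R u
  have hAB : A ≤ B :=
    adjoin_toSubring_le (hRT.trans (subring_le_adjoin T u)) (Algebra.self_mem_adjoin_singleton T u)
  set ιA := Subring.inclusion (subring_le_adjoin R u) with hιA
  set ιB := Subring.inclusion (subring_le_adjoin T u) with hιB
  -- the exceptional prime `𝔭 = 𝔪_R A = x A` of `A`
  set 𝔭 : Ideal A := (maximalIdeal R).map ιA with h𝔭def
  have h𝔭 : 𝔭.IsPrime := by
    have := isPrime_map_incl (K := K) hx0 hpqR (n := maximalIdeal R) hxm hym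
    rw [huR] at this
    exact this
  have h𝔭eq : 𝔭 = Ideal.span {ιA x} := by
    have := map_incl_span_pair (K := K) hx0 y
    rw [huR, ← hm] at this
    exact this
  -- the prime `P = 𝔪_T B` of `B`
  set P : Ideal B := (maximalIdeal T).map ιB with hPdef
  have hP : P.IsPrime := isPrime_map_incl (K := K) hx'0 hpqT hx'n hy'n
  -- `P ∩ A ⊆ 𝔭`
  have hPA : ∀ a : A, Subring.inclusion hAB a ∈ P → a ∈ 𝔭 := by
    intro a haP
    obtain ⟨G, hG⟩ := exists_aeval_eq_of_mem_adjoin a.2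
    obtain ⟨F, hFn, hFa⟩ := exists_aeval_eq_of_mem_map_incl haP
    have hf : (algebraMap T K).comp ι = algebraMap R K := RingHom.ext fun r => rfl
    have hG' : aeval u (G.map ι) = aeval u G := by
      rw [aeval_def, eval₂_map, hf, ← aeval_def]
    have hzero : aeval u (G.map ι - F) = 0 := by
      rw [map_sub, hG', hG, hFa, Subring.coe_inclusion, sub_self]
    have hGm : ∀ i, G.coeff i ∈ maximalIdeal R := by
      intro i
      have h1 : (G.map ι - F).coeff i ∈ maximalIdeal T :=
        span_pair_le_of_mem hx'n hy'n (coeff_mem_span_pair_of_aeval_eq_zero hx'0 hpqT hzero i)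
      rw [coeff_sub, coeff_map] at h1
      have h2 : ι (G.coeff i) ∈ maximalIdeal T := by
        simpa using (maximalIdeal T).add_mem h1 (hFn i)
      exact (incl_mem_maximalIdeal_iff hdom _).mp h2
    have e : a = ⟨aeval u G, Polynomial.aeval_mem_adjoin_singleton R u⟩ := Subtype.ext hG.symm
    rw [e, h𝔭def]
    exact aeval_mem_map_incl_of_coeff_mem hGm
  -- the local rings `V = A_𝔭 ⊆ D = B_P`
  haveI := h𝔭
  haveI := hP
  set V := (LocalSubring.ofPrime A 𝔭).toSubring with hV
  set D := (LocalSubring.ofPrime B P).toSubring with hD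
  have hVD : V ≤ D := by
    intro z hz
    obtain ⟨a, s, hs, rfl⟩ := mem_ofPrime_iff.mp hz
    refine mem_ofPrime_iff.mpr
      ⟨Subring.inclusion hAB a, Subring.inclusion hAB s, fun h => hs (hPA s h), ?_⟩
    -- (not `rfl`: keep the kernel away from unfolding `Algebra.adjoin`)
    rw [Subring.coe_inclusion, Subring.coe_inclusion]
  -- non-zero elements of `𝔪_T` are not invertible in `D`
  have hinvD : ∀ t : T, t ≠ 0 → t ∈ maximalIdeal T → ((t : T) : K)⁻¹ ∉ D := by
    intro t ht0 htn hmem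
    obtain ⟨b, s, hs, he⟩ := mem_ofPrime_iff.mp hmem
    apply hs
    have ht0K : ((t : T) : K) ≠ 0 := fun e => ht0 (Subtype.ext e)
    have hs0 := coe_ne_zero_of_not_mem (K := K) hs
    have e : s = ιB t * b := Subtype.ext (by
      rw [Subring.coe_mul, hιB, Subring.coe_inclusion]
      rw [eq_div_iff hs0] at he
      rw [← he, ← mul_assoc, mul_inv_cancel₀ ht0K, one_mul])
    rw [e]
    exact P.mul_mem_right _ (Ideal.mem_map_of_mem _ htn)
  have hxn : ι x ∈ maximalIdeal T := by
    rw [← hdx]; exact Ideal.mul_mem_left _ _ hx'n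
  have hιx0 : ι x ≠ 0 := by
    intro h
    apply hx0K
    have := congrArg (fun s : T => (s : K)) h
    simpa [hι] using this
  have hxinv : ((x : R) : K)⁻¹ ∉ D := by
    have := hinvD (ι x) hιx0 hxn
    simpa [hι] using this
  -- `K = Frac A`
  have hAK : ∀ z : K, ∃ a ∈ A, ∃ b ∈ A, b ≠ 0 ∧ z = a / b := by
    intro z
    obtain ⟨a, ha, b, hb, hb0, rfl⟩ := hRK.2 z
    exact ⟨a, subring_le_adjoin R u ha, b, subring_le_adjoin R u hb, hb0, rfl⟩
  -- `D ⊆ V` since `V` is a valuation ring and `1/x ∉ D`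
  have hDV : D ≤ V := by
    intro z hz
    rcases mem_or_inv_mem_ofPrime_of_span_singleton h𝔭eq hAK z with h | h
    · exact h
    · by_contra hzV
      have hz0 : z ≠ 0 := by
        rintro rfl; exact hzV V.zero_mem
      obtain ⟨w, hwV, hw⟩ := exists_eq_mul_of_inv_not_mem_ofPrime h𝔭eq h (by rwa [inv_inv])
      apply hxinv
      have e : ((x : R) : K)⁻¹ = z * w := by
        have hw' : z⁻¹ = ((x : R) : K) * w := by
          rw [hw, hιA, Subring.coe_inclusion]
        have h1 : ((x : R) : K) * (z * w) = 1 := by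
          rw [mul_left_comm, ← hw', mul_inv_cancel₀ hz0]
        exact inv_eq_of_mul_eq_one_right h1
      rw [e]
      exact D.mul_mem hz (hVD hwV)
  have hTV : T ≤ V := (subring_le_adjoin T u).trans ((LocalSubring.le_ofPrime B P).trans hDV)
  have hinvV : ∀ t : T, t ≠ 0 → t ∈ maximalIdeal T → ((t : T) : K)⁻¹ ∉ V :=
    fun t h0 hn hV => hinvD t h0 hn (hVD hV)
  -- (iii): `x' ∈ xV`, so `d⁻¹ ∈ V`, contradicting `d ∈ 𝔪_T`
  obtain ⟨w, hwV, hw⟩ :=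
    exists_eq_mul_of_inv_not_mem_ofPrime h𝔭eq (hTV x'.2) (hinvV x' hx'0 hx'n)
  have hw' : ((x' : T) : K) = ((x : R) : K) * w := by
    rw [hw, hιA, Subring.coe_inclusion]
  have hdw : ((d : T) : K) * w = 1 := by
    rw [hxK, mul_assoc, mul_left_comm] at hw'
    -- hw' : x' = x' * (d * w)
    have := mul_left_cancel₀ hx'0K (hw'.symm.trans (mul_one _).symm)
    exact this
  have hdinv : ((d : T) : K)⁻¹ = w := inv_eq_of_mul_eq_one_right hdw
  exact hinvV d hd0 hdn (hdinv ▸ hwV)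

include hR hRdim hRK hT hTdim hdom in
/-- **The key lemma (Huneke–Swanson, "the crucial point" of Thm. 14.5.2; Abhyankar 1956).** Let
`R ⊊ T` be two-dimensional regular local rings of `K = Frac R` with `T` dominating `R`. Then
there is a regular system of parameters `𝔪_R = (x, y)` (with `x ≠ 0` and `x ∣ yt ⇒ x ∣ t`) such
that `y/x ∈ T`, i.e. `𝔪_R T = xT` and `R[𝔪_R/x] ⊆ T`. Proof: in the UFD `T` write `x = dx'`,
`y = dy'` with `x', y'` relatively prime; by `gcd_mem_maximalIdeal` and `false_of_not_isUnit` one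
of `x', y'` is a unit. [cite: HunekeSwanson2006, Thm. 14.5.2 (proof, "the crucial point")] -/
theorem exists_rsop_div_mem_of_ne (hne : R ≠ T) :
    ∃ x y : R, maximalIdeal R = Ideal.span {x, y} ∧ x ≠ 0 ∧ (∀ t, x ∣ y * t → x ∣ t) ∧
      ((y : R) : K) / ((x : R) : K) ∈ T := by
  haveI := hR
  haveI := hT
  haveI := uniqueFactorizationMonoid_of_ringKrullDim_eq_two hTdim
  have hRT : R ≤ T := hdom.1
  set ι := Subring.inclusion hRT with hι
  obtain ⟨x, y, hm, hx, hy, hxy, hyx⟩ := exists_maximalIdeal_eq_span_pair (R := R) hRdim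
  have hιx0 : ι x ≠ 0 := by
    intro h
    apply hx.ne_zero
    have := congrArg (fun s : T => (s : K)) h
    exact Subtype.ext (by simpa [hι] using this)
  obtain ⟨x', y', d, hrel, hdx, hdy⟩ :=
    UniqueFactorizationMonoid.exists_reduced_factors (ι x) hιx0 (ι y)
  have hxK : ((x : R) : K) = (d : K) * (x' : K) := by
    have := congrArg (fun s : T => (s : K)) hdx
    simpa [hι] using this.symm
  have hyK : ((y : R) : K) = (d : K) * (y' : K) := by
    have := congrArg (fun s : T => (s : K)) hdy
    simpa [hι] using this.symm
  have hd0K : ((d : T) : K) ≠ 0 := by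
    intro h
    rw [h, zero_mul] at hxK
    exact hx.ne_zero (Subtype.ext hxK)
  by_cases hux : IsUnit x'
  · refine ⟨x, y, hm, hx.ne_zero, fun t h => (hx.dvd_or_dvd h).resolve_left hxy, ?_⟩
    rw [hxK, hyK, mul_div_mul_left _ _ hd0K, div_eq_mul_inv]
    exact T.mul_mem y'.2 ((isUnit_subring_iff_inv_mem x').mp hux).2
  by_cases huy : IsUnit y'
  · refine ⟨y, x, by rw [hm, Set.pair_comm], hy.ne_zero,
      fun t h => (hy.dvd_or_dvd h).resolve_left hyx, ?_⟩
    rw [hxK, hyK, mul_div_mul_left _ _ hd0K, div_eq_mul_inv]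
    exact T.mul_mem x'.2 ((isUnit_subring_iff_inv_mem y').mp huy).2
  exfalso
  have hdn := gcd_mem_maximalIdeal hR hRdim hRK hT hTdim hdom hne hm hrel hdx hdy
  exact false_of_not_isUnit hR hRK hT hdom hm hx hxy hrel hdx hdy
    ((IsLocalRing.mem_maximalIdeal _).mpr hux) ((IsLocalRing.mem_maximalIdeal _).mpr huy) hdn

end KeyLemma

end Literature.AlgebraicGeometry.Resolution

end
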